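import Summits.Ventures.CertifiedArithmetic.LowPrec.Round

/-!
# Directed roundings (down / up / toward zero) into a minifloat format and the SR two-point law

HONEST FRAMING (venture CertifiedArithmetic / cell `pub-lowprec`): certified error envelopes and
provably optimal rounding/accumulation schemes for low-precision formats under stated cost models;
every table by two implementations; no hardware or vendor claims.

On the magnitude grid of `φ` (file `RoundGrid.lean`): `Format.rdGrid r` = the largest representable
magnitude `≤ r` (for `0 ≤ r`; saturating: `= maxScaled` once `r ≥ maxScaled`) and `Format.ruGrid r`
= the smallest representable magnitude `≥ r` when `r ≤ maxScaled` (else `maxScaled`, with the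
out-of-range condition `maxScaled < r` kept as the separate flag an ∞-policy needs). Proved:
representability, the order relations, and OPTIMALITY (`le_rdGrid_of_le`: every representable
`n' ≤ r` is `≤ rdGrid r`; `ruGrid_le_of_le`: every representable `n' ≥ r` is `≥ ruGrid r`).
Signed data: `roundDown` / `roundUp` / `roundTowardZero : ℚ → MiniFloat φ` [IEEE7542019, §4.3.2]
with their value characterisations, and the STOCHASTIC-ROUNDING two-point law on a rational `x`
in range: neighbours `(roundDown x, roundUp x)` with `P(up) = (x - ↓x)/(↑x - ↓x)` (`0` when `x` is
representable), whose mean is exactly `x` (`srMean_eq`) — the unbiasedness identity of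
[ConnollyHighamMary2021, Lemma 4.4 / (2.4)] for values inside the representable range (no
statement is made outside it: there the upper neighbour does not exist).

Placement: venture development; dot-notation extensions of the Literature structures carry their
absolute `Literature.…` names (CONVENTIONS §2).
-/

namespace Literature.ComputerArithmetic.FloatingPoint

namespace Format

variable {φ : Format}

/-- Round DOWN on the magnitude grid: `⌊r / 2^s⌋ · 2^s` clamped at `maxScaled`
(`s` = local spacing exponent). [cite: IEEE7542019, §4.3.2] -/
def rdGrid (φ : Format) (r : ℚ) : ℕ :=
  min ((⌊r / (2 : ℚ) ^ φ.shift ⌊r⌋.toNat⌋).toNat * 2 ^ φ.shift ⌊r⌋.toNat) φ.maxScaled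

/-- Round UP on the magnitude grid: `⌈r / 2^s⌉ · 2^s` for `r ≤ maxScaled`, else `maxScaled`
(the out-of-range case is flagged by `maxScaled < r`). [cite: IEEE7542019, §4.3.2] -/
def ruGrid (φ : Format) (r : ℚ) : ℕ :=
  if r ≤ φ.maxScaled then (⌈r / (2 : ℚ) ^ φ.shift ⌊r⌋.toNat⌉).toNat * 2 ^ φ.shift ⌊r⌋.toNat
  else φ.maxScaled

/-- `rdGrid r ≤ maxScaled`. [folklore] -/
theorem rdGrid_le_maxScaled (r : ℚ) : φ.rdGrid r ≤ φ.maxScaled := min_le_right _ _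

/-- `rdGrid r ≤ r` for `r ≥ 0`. [folklore] -/
theorem rdGrid_le {r : ℚ} (hr : 0 ≤ r) : (φ.rdGrid r : ℚ) ≤ r := by
  unfold rdGrid
  set s := φ.shift ⌊r⌋.toNat with hs
  have hc : (0 : ℚ) < 2 ^ s := by positivity
  have h0 : 0 ≤ ⌊r / (2 : ℚ) ^ s⌋ := Int.floor_nonneg.mpr (div_nonneg hr hc.le)
  have h1 : (((⌊r / (2 : ℚ) ^ s⌋).toNat : ℕ) : ℤ) = ⌊r / (2 : ℚ) ^ s⌋ := Int.toNat_of_nonneg h0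
  have h2 : (⌊r / (2 : ℚ) ^ s⌋ : ℚ) ≤ r / 2 ^ s := Int.floor_le _
  have hmin : min ((⌊r / (2 : ℚ) ^ s⌋).toNat * 2 ^ s) φ.maxScaled ≤ (⌊r / (2 : ℚ) ^ s⌋).toNat * 2 ^ s :=
    min_le_left _ _
  have h3 : ((min ((⌊r / (2 : ℚ) ^ s⌋).toNat * 2 ^ s) φ.maxScaled : ℕ) : ℚ)
      ≤ (((⌊r / (2 : ℚ) ^ s⌋).toNat * 2 ^ s : ℕ) : ℚ) := by exact_mod_cast hmin
  refine le_trans h3 ?_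
  have h4 : (((⌊r / (2 : ℚ) ^ s⌋).toNat : ℕ) : ℚ) = (⌊r / (2 : ℚ) ^ s⌋ : ℚ) := by exact_mod_cast h1
  push_cast
  rw [h4]
  calc (⌊r / (2 : ℚ) ^ s⌋ : ℚ) * 2 ^ s ≤ r / 2 ^ s * 2 ^ s := mul_le_mul_of_nonneg_right h2 hc.le
    _ = r := div_mul_cancel₀ _ (ne_of_gt hc)

/-- The binade floor `2^(m+s)` lies below `⌊r/2^s⌋·2^s` when `2^(m+s) ≤ r`. [folklore] -/
theorem pow_le_floor_mul {r : ℚ} (hfloor : (2 : ℚ) ^ (φ.manBits + φ.shift ⌊r⌋.toNat) ≤ r) :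
    2 ^ (φ.manBits + φ.shift ⌊r⌋.toNat)
      ≤ (⌊r / (2 : ℚ) ^ φ.shift ⌊r⌋.toNat⌋).toNat * 2 ^ φ.shift ⌊r⌋.toNat := by
  have hc : (0 : ℚ) < 2 ^ φ.shift ⌊r⌋.toNat := by positivity
  have : ((2 ^ φ.manBits : ℕ) : ℤ) ≤ ⌊r / (2 : ℚ) ^ φ.shift ⌊r⌋.toNat⌋ := by
    rw [Int.le_floor]; push_cast
    rw [le_div_iff₀ hc, ← pow_add]; exact hfloor
  have h2 : 2 ^ φ.manBits ≤ (⌊r / (2 : ℚ) ^ φ.shift ⌊r⌋.toNat⌋).toNat := by omega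
  calc 2 ^ (φ.manBits + φ.shift ⌊r⌋.toNat) = 2 ^ φ.manBits * 2 ^ φ.shift ⌊r⌋.toNat := pow_add _ _ _
    _ ≤ _ := Nat.mul_le_mul_right _ h2

/-- OPTIMALITY of round-down: every representable magnitude `n' ≤ r` is `≤ rdGrid r`.
[cite: IEEE7542019, §4.3.2] -/
theorem le_rdGrid_of_le {r : ℚ} (hr : 0 ≤ r) {n' : ℕ} (hn' : φ.Representable n')
    (hle : (n' : ℚ) ≤ r) : n' ≤ φ.rdGrid r := by
  have hc : (0 : ℚ) < 2 ^ φ.shift ⌊r⌋.toNat := by positivity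
  have hn'max : n' ≤ φ.maxScaled := by obtain ⟨x, rfl⟩ := hn'; exact x.scaledMag_le_maxScaled
  unfold rdGrid
  refine le_min ?_ hn'max
  by_cases hdvd : 2 ^ φ.shift ⌊r⌋.toNat ∣ n'
  · obtain ⟨k, hk⟩ := hdvd
    have hkle : (k : ℤ) ≤ ⌊r / (2 : ℚ) ^ φ.shift ⌊r⌋.toNat⌋ := by
      rw [Int.le_floor, le_div_iff₀ hc]
      have : (n' : ℚ) = (k : ℚ) * 2 ^ φ.shift ⌊r⌋.toNat := by rw [hk]; push_cast; ring
      push_cast; linarith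
    rw [hk, mul_comm (2 ^ _) k]
    exact Nat.mul_le_mul_right _ (by omega)
  · have hlt : n' < 2 ^ (φ.manBits + φ.shift ⌊r⌋.toNat) := by
      by_contra hge; exact hdvd (pow_dvd_of_representable hn' (not_lt.mp hge))
    rcases shift_floor_dichotomy (φ := φ) hr with hs | hfloor
    · exact absurd (by rw [hs]; exact one_dvd _) hdvd
    · exact le_trans hlt.le (pow_le_floor_mul hfloor)

/-- `rdGrid r` is representable. [folklore] -/
theorem rdGrid_representable (r : ℚ) : φ.Representable (φ.rdGrid r) := by
  have hc : (0 : ℚ) < 2 ^ φ.shift ⌊r⌋.toNat := by positivity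
  unfold rdGrid
  rcases le_total ((⌊r / (2 : ℚ) ^ φ.shift ⌊r⌋.toNat⌋).toNat * 2 ^ φ.shift ⌊r⌋.toNat) φ.maxScaled
    with h | h
  · rw [min_eq_left h]
    -- quotient bound: ⌊r/2^s⌋ ≤ rneInt? no: use the binade top
    rcases Nat.lt_or_ge (φ.shift ⌊r⌋.toNat) (φ.emaxCode - 1) with hs | hs
    · have hr' := lt_pow_of_shift_floor_lt (φ := φ) hs
      have hq : (⌊r / (2 : ℚ) ^ φ.shift ⌊r⌋.toNat⌋).toNat < 2 ^ (φ.manBits + 1) := by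
        have : ⌊r / (2 : ℚ) ^ φ.shift ⌊r⌋.toNat⌋ < ((2 ^ (φ.manBits + 1) : ℕ) : ℤ) := by
          rw [Int.floor_lt]; push_cast
          rw [div_lt_iff₀ hc, ← pow_add]; exact hr'
        have := Nat.two_pow_pos (φ.manBits + 1)
        omega
      exact MiniFloat.representable_mul_pow hq h
    · have hs' : φ.shift ⌊r⌋.toNat = φ.emaxCode - 1 := le_antisymm (shift_le _) hs
      have htop := φ.topMan_lt
      have hmax : φ.maxScaled ≤ (2 ^ φ.manBits + φ.topMan) * 2 ^ φ.shift ⌊r⌋.toNat := by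
        rw [hs']; unfold maxScaled scaled
        split
        · calc φ.topMan ≤ (2 ^ φ.manBits + φ.topMan) * 1 := by omega
            _ ≤ _ := Nat.mul_le_mul_left _ Nat.one_le_two_pow
        · exact le_rfl
      have hq : (⌊r / (2 : ℚ) ^ φ.shift ⌊r⌋.toNat⌋).toNat < 2 ^ (φ.manBits + 1) := by
        have h2 := Nat.le_of_mul_le_mul_right (le_trans h hmax) (by positivity)
        have := φ.topMan_lt; have := Nat.two_pow_pos φ.manBits; rw [pow_succ]; omega
      exact MiniFloat.representable_mul_pow hq h
  · rw [min_eq_right h]; exact MiniFloat.representable_maxScaled φ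

/-- Round-down of a representable magnitude is itself. [folklore] -/
theorem rdGrid_eq_self_of_representable {n : ℕ} (hn : φ.Representable n) : φ.rdGrid (n : ℚ) = n :=
  le_antisymm (by exact_mod_cast rdGrid_le (φ := φ) (Nat.cast_nonneg n))
    (le_rdGrid_of_le (Nat.cast_nonneg n) hn le_rfl)

/-- In range, `r ≤ ruGrid r`. [folklore] -/
theorem le_ruGrid {r : ℚ} (hle : r ≤ φ.maxScaled) : r ≤ (φ.ruGrid r : ℚ) := by
  have hc : (0 : ℚ) < 2 ^ φ.shift ⌊r⌋.toNat := by positivity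
  unfold ruGrid; rw [if_pos hle]
  have h1 : r / (2 : ℚ) ^ φ.shift ⌊r⌋.toNat ≤ (⌈r / (2 : ℚ) ^ φ.shift ⌊r⌋.toNat⌉ : ℚ) := Int.le_ceil _
  have h2 : (⌈r / (2 : ℚ) ^ φ.shift ⌊r⌋.toNat⌉ : ℚ) ≤ ((⌈r / (2 : ℚ) ^ φ.shift ⌊r⌋.toNat⌉.toNat : ℕ) : ℚ) := by
    have := Int.self_le_toNat ⌈r / (2 : ℚ) ^ φ.shift ⌊r⌋.toNat⌉; exact_mod_cast this
  push_cast
  calc r = r / (2 : ℚ) ^ φ.shift ⌊r⌋.toNat * 2 ^ φ.shift ⌊r⌋.toNat := (div_mul_cancel₀ _ (ne_of_gt hc)).symm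
    _ ≤ _ := mul_le_mul_of_nonneg_right (le_trans h1 h2) hc.le

/-- OPTIMALITY of round-up: in range, every representable magnitude `n' ≥ r ≥ 0` is `≥ ruGrid r`.
[cite: IEEE7542019, §4.3.2] -/
theorem ruGrid_le_of_le {r : ℚ} (hr : 0 ≤ r) (hle : r ≤ φ.maxScaled) {n' : ℕ}
    (hn' : φ.Representable n') (hge : r ≤ (n' : ℚ)) : φ.ruGrid r ≤ n' := by
  have hc : (0 : ℚ) < 2 ^ φ.shift ⌊r⌋.toNat := by positivity
  unfold ruGrid; rw [if_pos hle]
  have h0 : 0 ≤ ⌈r / (2 : ℚ) ^ φ.shift ⌊r⌋.toNat⌉ := Int.ceil_nonneg (div_nonneg hr hc.le)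
  by_cases hdvd : 2 ^ φ.shift ⌊r⌋.toNat ∣ n'
  · obtain ⟨k, hk⟩ := hdvd
    have hkge : ⌈r / (2 : ℚ) ^ φ.shift ⌊r⌋.toNat⌉ ≤ (k : ℤ) := by
      rw [Int.ceil_le, div_le_iff₀ hc]
      have : (n' : ℚ) = (k : ℚ) * 2 ^ φ.shift ⌊r⌋.toNat := by rw [hk]; push_cast; ring
      push_cast; linarith
    rw [hk, mul_comm (2 ^ _) k]
    exact Nat.mul_le_mul_right _ (by omega)
  · exfalso
    have hlt : n' < 2 ^ (φ.manBits + φ.shift ⌊r⌋.toNat) := by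
      by_contra hge'; exact hdvd (pow_dvd_of_representable hn' (not_lt.mp hge'))
    rcases shift_floor_dichotomy (φ := φ) hr with hs | hfloor
    · exact hdvd (by rw [hs]; exact one_dvd _)
    · have : (n' : ℚ) < 2 ^ (φ.manBits + φ.shift ⌊r⌋.toNat) := by exact_mod_cast hlt
      linarith

/-- `ruGrid r ≤ maxScaled` (in range the ceiling multiple stays in range because `maxScaled` is a
multiple of the spacing above `r`). [folklore] -/
theorem ruGrid_le_maxScaled {r : ℚ} (hr : 0 ≤ r) : φ.ruGrid r ≤ φ.maxScaled := by
  by_cases hle : r ≤ φ.maxScaled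
  · exact ruGrid_le_of_le hr hle (MiniFloat.representable_maxScaled φ) hle
  · unfold ruGrid; rw [if_neg hle]

/-- `ruGrid r` is representable (for `r ≥ 0`). [folklore] -/
theorem ruGrid_representable {r : ℚ} (hr : 0 ≤ r) : φ.Representable (φ.ruGrid r) := by
  have hc : (0 : ℚ) < 2 ^ φ.shift ⌊r⌋.toNat := by positivity
  have hmax := ruGrid_le_maxScaled (φ := φ) hr
  by_cases hle : r ≤ φ.maxScaled
  · unfold ruGrid at hmax ⊢; rw [if_pos hle] at hmax ⊢
    rcases Nat.lt_or_ge (φ.shift ⌊r⌋.toNat) (φ.emaxCode - 1) with hs | hs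
    · have hr' := lt_pow_of_shift_floor_lt (φ := φ) hs
      have hq : (⌈r / (2 : ℚ) ^ φ.shift ⌊r⌋.toNat⌉).toNat ≤ 2 ^ (φ.manBits + 1) := by
        have : ⌈r / (2 : ℚ) ^ φ.shift ⌊r⌋.toNat⌉ ≤ ((2 ^ (φ.manBits + 1) : ℕ) : ℤ) := by
          rw [Int.ceil_le]; push_cast
          rw [div_le_iff₀ hc, ← pow_add]; exact hr'.le
        have := Nat.two_pow_pos (φ.manBits + 1)
        omega
      rcases Nat.lt_or_ge (⌈r / (2 : ℚ) ^ φ.shift ⌊r⌋.toNat⌉).toNat (2 ^ (φ.manBits + 1)) with h | h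
      · exact MiniFloat.representable_mul_pow h hmax
      · have heq : (⌈r / (2 : ℚ) ^ φ.shift ⌊r⌋.toNat⌉).toNat = 2 ^ (φ.manBits + 1) := le_antisymm hq h
        rw [heq, ← pow_add, ← one_mul (2 ^ _)]
        refine MiniFloat.representable_mul_pow (Nat.one_lt_two_pow (by omega)) ?_
        rw [one_mul, pow_add, ← heq]; exact hmax
    · have hs' : φ.shift ⌊r⌋.toNat = φ.emaxCode - 1 := le_antisymm (shift_le _) hs
      have htop := φ.topMan_lt
      have hM : φ.maxScaled ≤ (2 ^ φ.manBits + φ.topMan) * 2 ^ φ.shift ⌊r⌋.toNat := by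
        rw [hs']; unfold maxScaled scaled
        split
        · calc φ.topMan ≤ (2 ^ φ.manBits + φ.topMan) * 1 := by omega
            _ ≤ _ := Nat.mul_le_mul_left _ Nat.one_le_two_pow
        · exact le_rfl
      have hq : (⌈r / (2 : ℚ) ^ φ.shift ⌊r⌋.toNat⌉).toNat < 2 ^ (φ.manBits + 1) := by
        have h2 := Nat.le_of_mul_le_mul_right (le_trans hmax hM) (by positivity)
        have := φ.topMan_lt; have := Nat.two_pow_pos φ.manBits; rw [pow_succ]; omega
      exact MiniFloat.representable_mul_pow hq hmax
  · unfold ruGrid; rw [if_neg hle]; exact MiniFloat.representable_maxScaled φ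

/-- Round-up of a representable magnitude is itself. [folklore] -/
theorem ruGrid_eq_self_of_representable {n : ℕ} (hn : φ.Representable n) : φ.ruGrid (n : ℚ) = n := by
  have hle : (n : ℚ) ≤ φ.maxScaled := by
    obtain ⟨x, rfl⟩ := hn; exact_mod_cast x.scaledMag_le_maxScaled
  exact le_antisymm (ruGrid_le_of_le (Nat.cast_nonneg n) hle hn le_rfl)
    (by exact_mod_cast le_ruGrid (φ := φ) hle)

end Format

/-! ### Signed directed roundings -/

/-- IEEE roundTowardNegative into `φ` (saturating at `-top` below `-maxRat`): magnitude rounded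
down for `x ≥ 0`, up for `x < 0`. [cite: IEEE7542019, §4.3.2] -/
def roundDown (φ : Format) (x : ℚ) : MiniFloat φ :=
  if x < 0 then MiniFloat.ofScaled φ true (φ.ruGrid (|x| / φ.quantum))
      (Format.ruGrid_le_maxScaled (div_nonneg (abs_nonneg x) φ.quantum_pos.le))
  else MiniFloat.ofScaled φ false (φ.rdGrid (|x| / φ.quantum)) (Format.rdGrid_le_maxScaled _)

/-- IEEE roundTowardPositive into `φ` (saturating at `+top` above `maxRat`): magnitude rounded up
for `x ≥ 0`, down for `x < 0` (so `x ∈ (-quantum, 0)` gives `-0`). [cite: IEEE7542019, §4.3.2] -/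
def roundUp (φ : Format) (x : ℚ) : MiniFloat φ :=
  if x < 0 then MiniFloat.ofScaled φ true (φ.rdGrid (|x| / φ.quantum)) (Format.rdGrid_le_maxScaled _)
  else MiniFloat.ofScaled φ false (φ.ruGrid (|x| / φ.quantum))
      (Format.ruGrid_le_maxScaled (div_nonneg (abs_nonneg x) φ.quantum_pos.le))

/-- IEEE roundTowardZero into `φ`: magnitude rounded down, sign of the input.
[cite: IEEE7542019, §4.3.2] -/
def roundTowardZero (φ : Format) (x : ℚ) : MiniFloat φ :=
  MiniFloat.ofScaled φ (decide (x < 0)) (φ.rdGrid (|x| / φ.quantum)) (Format.rdGrid_le_maxScaled _)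

namespace MiniFloat

variable {φ : Format}

/-- Value of `roundDown`. [folklore] -/
theorem toRat_roundDown (x : ℚ) : (roundDown φ x).toRat =
    if x < 0 then -((φ.ruGrid (|x| / φ.quantum) : ℕ) : ℚ) * φ.quantum
    else ((φ.rdGrid (|x| / φ.quantum) : ℕ) : ℚ) * φ.quantum := by
  have hr : 0 ≤ |x| / φ.quantum := div_nonneg (abs_nonneg x) φ.quantum_pos.le
  unfold roundDown
  split
  · rw [toRat_ofScaled _ (Format.ruGrid_representable hr)]; simp
  · rw [toRat_ofScaled _ (Format.rdGrid_representable _)]; simp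

/-- Value of `roundUp`. [folklore] -/
theorem toRat_roundUp (x : ℚ) : (roundUp φ x).toRat =
    if x < 0 then -((φ.rdGrid (|x| / φ.quantum) : ℕ) : ℚ) * φ.quantum
    else ((φ.ruGrid (|x| / φ.quantum) : ℕ) : ℚ) * φ.quantum := by
  have hr : 0 ≤ |x| / φ.quantum := div_nonneg (abs_nonneg x) φ.quantum_pos.le
  unfold roundUp
  split
  · rw [toRat_ofScaled _ (Format.rdGrid_representable _)]; simp
  · rw [toRat_ofScaled _ (Format.ruGrid_representable hr)]; simp

/-- Value of `roundTowardZero`. [folklore] -/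
theorem toRat_roundTowardZero (x : ℚ) : (roundTowardZero φ x).toRat =
    (if x < 0 then -((φ.rdGrid (|x| / φ.quantum) : ℕ) : ℚ) else (φ.rdGrid (|x| / φ.quantum) : ℕ))
      * φ.quantum := by
  unfold roundTowardZero
  rw [toRat_ofScaled _ (Format.rdGrid_representable _)]
  by_cases hx : x < 0 <;> simp [hx]

/-- ROUND-DOWN IS BELOW: for `|x| ≤ maxRat`, `(roundDown φ x).toRat ≤ x`. [cite: IEEE7542019, §4.3.2] -/
theorem toRat_roundDown_le {x : ℚ} (h : |x| ≤ φ.maxRat) : (roundDown φ x).toRat ≤ x := by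
  have hq := φ.quantum_pos
  have hr : 0 ≤ |x| / φ.quantum := div_nonneg (abs_nonneg x) hq.le
  have hle : |x| / φ.quantum ≤ φ.maxScaled := by rw [div_le_iff₀ hq]; exact h
  rw [toRat_roundDown]
  split
  · rename_i hx
    have h1 := Format.le_ruGrid (φ := φ) hle
    rw [abs_of_neg hx] at h1 ⊢
    rw [div_le_iff₀ hq] at h1
    linarith
  · rename_i hx
    have h1 := Format.rdGrid_le (φ := φ) hr
    rw [abs_of_nonneg (not_lt.mp hx)] at h1 ⊢
    exact (le_div_iff₀ hq).mp h1

/-- ROUND-DOWN IS THE LARGEST value below: every finite `y` with `y.toRat ≤ x` satisfies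
`y.toRat ≤ (roundDown φ x).toRat` (for `|x| ≤ maxRat`). [cite: IEEE7542019, §4.3.2] -/
theorem toRat_le_roundDown {x : ℚ} (h : |x| ≤ φ.maxRat) (y : MiniFloat φ) (hy : y.toRat ≤ x) :
    y.toRat ≤ (roundDown φ x).toRat := by
  have hq := φ.quantum_pos
  have hr : 0 ≤ |x| / φ.quantum := div_nonneg (abs_nonneg x) hq.le
  have hle : |x| / φ.quantum ≤ φ.maxScaled := by rw [div_le_iff₀ hq]; exact h
  have hyv : y.toRat = (y.toInt : ℚ) * φ.quantum := rfl
  rw [toRat_roundDown]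
  split
  · rename_i hx
    -- y ≤ x < 0: y is negative with magnitude n_y ≥ r, hence n_y ≥ ruGrid r
    have hyneg : y.toRat < 0 := lt_of_le_of_lt hy hx
    have hn : y.neg = true := by
      unfold toRat toInt at hyneg
      by_contra hne
      rw [Bool.not_eq_true] at hne
      rw [hne] at hyneg; simp at hyneg
      exact absurd hyneg (not_lt.mpr (mul_nonneg (Nat.cast_nonneg _) hq.le))
    have hyval : y.toRat = -(y.scaledMag : ℚ) * φ.quantum := by
      unfold toRat toInt; rw [hn]; simp
    rw [hyval] at hy ⊢
    have hge : |x| / φ.quantum ≤ (y.scaledMag : ℚ) := by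
      rw [abs_of_neg hx, div_le_iff₀ hq]; linarith
    have := Format.ruGrid_le_of_le hr hle y.representable_scaledMag hge
    have : ((φ.ruGrid (|x| / φ.quantum) : ℕ) : ℚ) ≤ y.scaledMag := by exact_mod_cast this
    nlinarith
  · rename_i hx
    have hx' : 0 ≤ x := not_lt.mp hx
    by_cases hn : y.neg = true
    · -- negative (or -0) y is ≤ 0 ≤ roundDown x
      have hyval : y.toRat = -(y.scaledMag : ℚ) * φ.quantum := by
        unfold toRat toInt; rw [hn]; simp
      rw [hyval]
      have : (0 : ℚ) ≤ (φ.rdGrid (|x| / φ.quantum) : ℕ) := Nat.cast_nonneg _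
      nlinarith [Nat.cast_nonneg (α := ℚ) y.scaledMag]
    · rw [Bool.not_eq_true] at hn
      have hyval : y.toRat = (y.scaledMag : ℚ) * φ.quantum := by
        unfold toRat toInt; rw [hn]; simp
      rw [hyval] at hy ⊢
      have hle' : (y.scaledMag : ℚ) ≤ |x| / φ.quantum := by
        rw [abs_of_nonneg hx', le_div_iff₀ hq]; exact hy
      have := Format.le_rdGrid_of_le hr y.representable_scaledMag hle'
      have : (y.scaledMag : ℚ) ≤ (φ.rdGrid (|x| / φ.quantum) : ℕ) := by exact_mod_cast this
      nlinarith

/-- `roundUp` is the mirror image of `roundDown`: `(roundUp φ x).toRat = -(roundDown φ (-x)).toRat`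
for `x ≠ 0`. [folklore] -/
theorem toRat_roundUp_eq_neg {x : ℚ} (hx : x ≠ 0) : (roundUp φ x).toRat = -(roundDown φ (-x)).toRat := by
  rw [toRat_roundUp, toRat_roundDown, abs_neg]
  rcases lt_or_gt_of_ne hx with h | h
  · rw [if_pos h, if_neg (by linarith)]; ring
  · rw [if_neg (not_lt.mpr h.le), if_pos (by linarith)]; ring

/-- ROUND-UP IS ABOVE: for `|x| ≤ maxRat`, `x ≤ (roundUp φ x).toRat`. [cite: IEEE7542019, §4.3.2] -/
theorem le_toRat_roundUp {x : ℚ} (h : |x| ≤ φ.maxRat) : x ≤ (roundUp φ x).toRat := by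
  by_cases hx : x = 0
  · subst hx
    rw [toRat_roundUp, if_neg (lt_irrefl 0)]
    exact mul_nonneg (Nat.cast_nonneg _) φ.quantum_pos.le
  · rw [toRat_roundUp_eq_neg hx]
    have := toRat_roundDown_le (φ := φ) (x := -x) (by rwa [abs_neg])
    linarith

/-- ROUND-UP IS THE SMALLEST value above: every finite `y` with `x ≤ y.toRat` satisfies
`(roundUp φ x).toRat ≤ y.toRat` (for `|x| ≤ maxRat`). [cite: IEEE7542019, §4.3.2] -/
theorem roundUp_le_toRat {x : ℚ} (h : |x| ≤ φ.maxRat) (y : MiniFloat φ) (hy : x ≤ y.toRat) :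
    (roundUp φ x).toRat ≤ y.toRat := by
  by_cases hx : x = 0
  · subst hx
    rw [toRat_roundUp, if_neg (lt_irrefl 0), abs_zero, zero_div]
    have h0 : φ.ruGrid ((0 : ℕ) : ℚ) = 0 :=
      Format.ruGrid_eq_self_of_representable
        (representable_of_lt_pow (Nat.two_pow_pos _) (Nat.zero_le _))
    rw [Nat.cast_zero] at h0
    rw [h0]; simpa using hy
  · rw [toRat_roundUp_eq_neg hx]
    have := toRat_le_roundDown (φ := φ) (x := -x) (by rwa [abs_neg]) y.flipSign
      (by rw [toRat_flipSign]; linarith)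
    rw [toRat_flipSign] at this
    linarith

end MiniFloat

end Literature.ComputerArithmetic.FloatingPoint
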